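import Summits.ResolutionOfSingularities.ResolutionOfSingularities.Theorems.FrobeniusLadderFInjectiveMacaulayficationWeightedConeFiModel
import Summits.ResolutionOfSingularities.ResolutionOfSingularities.Theorems.FrobeniusLadderFInjectiveMacaulayficationBP237VeroneseSplitting
import Summits.ResolutionOfSingularities.ResolutionOfSingularities.Theorems.FrobeniusLadderFInjectiveMacaulayficationBP237Charts
import Summits.ResolutionOfSingularities.ResolutionOfSingularities.Theorems.FrobeniusLadderFInjectiveMacaulayficationE8Forms
import Mathlib.Algebra.MvPolynomial.PDeriv
import Mathlib.Algebra.Polynomial.Degree.Domain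
import HarnessLib

/-!
# One weighted blow-up F-injectivizes the Brieskorn–Pham point `z² + x³ + y⁷ = 0` (`p ∉ {2,3,7}`)
(crux `FInjectiveMacaulayfication`, line `Sketch`, §15 weighted cone engine — BP-TAME CALIBRATION, target)

Support file for crux stmt-ResolutionOfSingularities-15315 (`FrobeniusLadder.FInjectiveMacaulayfication`,
line `Sketch`). [OURS · L1 W4.5a, CRUX-PLAN §6] — the target statement `bp237WeightedFiModel` typed by plan-1
(`L/w45a/BP237-statements.lean`), proved: for every prime `p ∉ {2, 3, 7}` and every field `k` of characteristic
`p`, the weighted blow-up of the origin of the surface `f = X₂² + X₀³ + X₁⁷ = 0` (`X₀ = x`, `X₁ = y`, `X₂ = z`,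
weights `w = (14, 6, 21)`, centre `I₈₄` = monomials of weighted degree `≥ 84`, `c = (6, 14, 4)`, `D = 42`) is
proper, birational, and its stalks are Cohen–Macaulay F-injective domains — an F-injective Macaulayfication in
ONE weighted step, where every tower of point blow-ups fails (kit survey j023222, `SURVEY-fpurify-point-blowups.md`).

* `prime_bp237` — `f` is prime over any field and divides no variable (`k[X₀,X₁,X₂] ≃ k[Y₀,Y₁][T]`, `X₂ ↦ T`,
  `f ↦ T² + c`, `-c ↦ -T³` under `Y₀ ↦ 0, Y₁ ↦ -T`: `E8Forms.prime_and_not_dvd_of_ringEquiv`).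
* `pderiv_zero_f`, `pderiv_one_f`, `pderiv_two_f` — `∂₀f = 3X₀²`, `∂₁f = 7X₁⁶`, `∂₂f = 2X₂`.
* `bp237OffOrigin` — for `p ∉ {2,3,7}` the clause holds at every maximal ideal of `k[X]/(f)` missing some `x̄ⱼ`
  (all partials in `P` would put `X₀, X₁, X₂ ∈ P`; otherwise the Jacobian discharger).
* `bp237WeightedFiModel` — THE TARGET: the weighted cone engine `WeightedConeFiModel.stub_weightedConeFiModel`
  (#23, p-id in the tree) at `n = 3`, `w = (14,6,21)`, `N = 84`, `D = 42`, `c = (6,14,4)`, fed with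
  `BP237VeroneseSplitting.bp237VeroneseSplitting` (saturation), `BP237Charts.bp237ChartX/Y/Z` (charts) and the
  two facts above.

Conjectural family form (OURS, docstring only, no item): for a Brieskorn–Pham hypersurface `Σᵢ xᵢ^{aᵢ}` and
`p ∤ ∏ aᵢ`, one weighted blow-up with `N` a Veronese-saturated multiple of `lcm(aᵢ)` should be an F-injective
Macaulayfication of the origin (all cover charts are smooth); only the saturation arithmetic is specimen-specific.

References: [Matsumura1987] H. Matsumura, *Commutative Ring Theory*, Thm. 30.4 (through the imported Jacobian
discharger); the rest is glue on the tree's engine. [folklore]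
-/

-- single-problem summit: the doubled namespace component is forced
set_option linter.dupNamespace false

noncomputable section

open CategoryTheory AlgebraicGeometry

namespace Summit.ResolutionOfSingularities.ResolutionOfSingularities.Theorems.FInjectiveMacaulayfication.BP237WeightedFiModel

open MvPolynomial
open Summit.ResolutionOfSingularities.ResolutionOfSingularities.Theorems.FInjectiveMacaulayfication

/-! ## Primality of `z² + x³ + y⁷` and the variables are non-zero modulo it -/

/-- **`f = X₂² + X₀³ + X₁⁷` is prime over every field and divides no variable.** Identify `k[X₀,X₁,X₂]` with
`k[Y₀,Y₁][T]` (`X₂ ↦ T`, `X₀ ↦ C Y₁`, `X₁ ↦ C Y₀`); `f ↦ T² + c` with `c = Y₁³ + Y₀⁷`, `-c` a non-square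
(`Y₀ ↦ 0, Y₁ ↦ -T` gives `-T³`), so `E8Forms.prime_and_not_dvd_of_ringEquiv` applies; `X₀, X₁` go to non-zero
constants, and `f ∤ X₂` by degree. [folklore] -/
theorem prime_bp237 (k : Type) [Field k] (f : MvPolynomial (Fin 3) k)
    (hf : f = MvPolynomial.X 2 ^ 2 + MvPolynomial.X 0 ^ 3 + MvPolynomial.X 1 ^ 7) :
    Prime f ∧ ∀ v : Fin 3, ¬ f ∣ MvPolynomial.X v := by
  obtain ⟨e, he0, he1, he2⟩ : ∃ e : MvPolynomial (Fin 3) k ≃+* Polynomial (MvPolynomial (Fin 2) k),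
      e (MvPolynomial.X 0) = Polynomial.C (MvPolynomial.X 1) ∧
        e (MvPolynomial.X 1) = Polynomial.C (MvPolynomial.X 0) ∧ e (MvPolynomial.X 2) = Polynomial.X := by
    refine ⟨((MvPolynomial.renameEquiv k (Equiv.swap (0 : Fin 3) 2)).trans
      (MvPolynomial.finSuccEquiv k 2)).toRingEquiv, ?_, ?_, ?_⟩
    · show MvPolynomial.finSuccEquiv k 2
          (MvPolynomial.rename (Equiv.swap (0 : Fin 3) 2) (MvPolynomial.X 0)) = _
      rw [MvPolynomial.rename_X, Equiv.swap_apply_left]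
      exact MvPolynomial.finSuccEquiv_X_succ (j := 1)
    · show MvPolynomial.finSuccEquiv k 2
          (MvPolynomial.rename (Equiv.swap (0 : Fin 3) 2) (MvPolynomial.X 1)) = _
      rw [MvPolynomial.rename_X, Equiv.swap_apply_of_ne_of_ne (by decide) (by decide)]
      exact MvPolynomial.finSuccEquiv_X_succ (j := 0)
    · show MvPolynomial.finSuccEquiv k 2
          (MvPolynomial.rename (Equiv.swap (0 : Fin 3) 2) (MvPolynomial.X 2)) = _
      rw [MvPolynomial.rename_X, Equiv.swap_apply_right]
      exact MvPolynomial.finSuccEquiv_X_zero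
  have hef : e f = Polynomial.X ^ 2 + Polynomial.C (MvPolynomial.X 1 ^ 3 + MvPolynomial.X 0 ^ 7) := by
    subst hf
    simp only [map_add, map_pow, he0, he1, he2]
    ring
  have hc : ∀ a : MvPolynomial (Fin 2) k, a * a ≠ -(MvPolynomial.X 1 ^ 3 + MvPolynomial.X 0 ^ 7) :=
    E8Forms.mul_self_ne_neg_of_aeval ![0, -Polynomial.X] 1 (by
      simp only [map_add, map_pow, MvPolynomial.aeval_X, Matrix.cons_val_zero, Matrix.cons_val_one]
      ring)
  obtain ⟨hp, hnd⟩ := E8Forms.prime_and_not_dvd_of_ringEquiv e f _ hef hc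
  refine ⟨hp, fun v => ?_⟩
  fin_cases v
  · exact hnd (MvPolynomial.X 0) (MvPolynomial.X 1) (MvPolynomial.X_ne_zero 1) he0
  · exact hnd (MvPolynomial.X 1) (MvPolynomial.X 0) (MvPolynomial.X_ne_zero 0) he1
  · rintro ⟨q, hq⟩
    have h1 : (Polynomial.X ^ 2 + Polynomial.C (MvPolynomial.X 1 ^ 3 + MvPolynomial.X 0 ^ 7) :
        Polynomial (MvPolynomial (Fin 2) k)) ∣ Polynomial.X :=
      ⟨e q, by rw [← hef, ← map_mul, ← hq]; exact he2.symm⟩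
    have h2 := Polynomial.natDegree_le_of_dvd h1 Polynomial.X_ne_zero
    rw [Polynomial.natDegree_X_pow_add_C, Polynomial.natDegree_X] at h2
    omega

/-! ## Partial derivatives of `f` -/

/-- `∂₀ (X₂² + X₀³ + X₁⁷) = 3X₀²`. [folklore] -/
theorem pderiv_zero_f {A : Type*} [CommRing A] :
    pderiv 0 (X 2 ^ 2 + X 0 ^ 3 + X 1 ^ 7 : MvPolynomial (Fin 3) A) = 3 * X 0 ^ 2 := by
  simp only [map_add, pderiv_pow, pderiv_X_self,
    pderiv_X_of_ne (show (2 : Fin 3) ≠ 0 by decide), pderiv_X_of_ne (show (1 : Fin 3) ≠ 0 by decide),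
    Nat.reduceSub, mul_one, mul_zero, add_zero, zero_add, Nat.cast_ofNat]

/-- `∂₁ (X₂² + X₀³ + X₁⁷) = 7X₁⁶`. [folklore] -/
theorem pderiv_one_f {A : Type*} [CommRing A] :
    pderiv 1 (X 2 ^ 2 + X 0 ^ 3 + X 1 ^ 7 : MvPolynomial (Fin 3) A) = 7 * X 1 ^ 6 := by
  simp only [map_add, pderiv_pow, pderiv_X_self,
    pderiv_X_of_ne (show (2 : Fin 3) ≠ 1 by decide), pderiv_X_of_ne (show (0 : Fin 3) ≠ 1 by decide),
    Nat.reduceSub, mul_one, mul_zero, add_zero, zero_add, Nat.cast_ofNat]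

/-- `∂₂ (X₂² + X₀³ + X₁⁷) = 2X₂`. [folklore] -/
theorem pderiv_two_f {A : Type*} [CommRing A] :
    pderiv 2 (X 2 ^ 2 + X 0 ^ 3 + X 1 ^ 7 : MvPolynomial (Fin 3) A) = 2 * X 2 := by
  simp only [map_add, pderiv_pow, pderiv_X_self,
    pderiv_X_of_ne (show (0 : Fin 3) ≠ 2 by decide), pderiv_X_of_ne (show (1 : Fin 3) ≠ 2 by decide),
    Nat.reduceSub, pow_one, mul_one, mul_zero, add_zero, Nat.cast_ofNat]

/-! ## The clause off the origin -/

/-- **Off the origin the surface `z² + x³ + y⁷ = 0` is smooth** (`p ∉ {2,3,7}`): at every maximal ideal `Q` of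
`k[X]/(f)` missing some `x̄ⱼ` the local ring satisfies the Cohen–Macaulay + Frobenius-closed clause — some
partial `3X₀², 7X₁⁶, 2X₂` misses `P = Q ∩ k[X]` (else `X₀, X₁, X₂ ∈ P`, contradicting `x̄ⱼ ∉ Q`), and the
Jacobian discharger `ClauseOfPderivNotMem.stub_clauseOfPderivNotMem` applies. [folklore] -/
theorem bp237OffOrigin (p : ℕ) [Fact p.Prime] (k : Type) [Field k] [CharP k p]
    (hp2 : p ≠ 2) (hp3 : p ≠ 3) (hp7 : p ≠ 7) (f : MvPolynomial (Fin 3) k)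
    (hf : f = MvPolynomial.X 2 ^ 2 + MvPolynomial.X 0 ^ 3 + MvPolynomial.X 1 ^ 7) :
    ∀ (Q : Ideal (MvPolynomial (Fin 3) k ⧸ Ideal.span {f})) [Q.IsMaximal],
      (∃ j : Fin 3, Ideal.Quotient.mk (Ideal.span {f}) (MvPolynomial.X j) ∉ Q) →
      ∀ d : ℕ, ringKrullDim (Localization.AtPrime Q) = d → ∀ s : Fin d → Localization.AtPrime Q,
        (Ideal.span (Set.range s)).radical.IsMaximal →
          RingTheory.Sequence.IsWeaklyRegular (Localization.AtPrime Q) (List.ofFn s) ∧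
          ∀ y : Localization.AtPrime Q, (∃ e : ℕ, y ^ p ^ e ∈ Ideal.span
            ((fun z : Localization.AtPrime Q => z ^ p ^ e) ''
              (Ideal.span (Set.range s) : Set (Localization.AtPrime Q)))) → y ∈ Ideal.span (Set.range s) := by
  intro Q _ hj d hd s hs
  haveI hP₀max : (Q.comap (Ideal.Quotient.mk (Ideal.span {f}))).IsMaximal :=
    Ideal.comap_isMaximal_of_surjective _ Ideal.Quotient.mk_surjective
  have hP₀ := hP₀max.isPrime
  have hu2 : IsUnit (2 : MvPolynomial (Fin 3) k) := by
    simpa using BP237Charts.isUnit_natCast_of_ne p k 2 Nat.prime_two hp2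
  have hu3 : IsUnit (3 : MvPolynomial (Fin 3) k) := by
    simpa using BP237Charts.isUnit_natCast_of_ne p k 3 Nat.prime_three hp3
  have hu7 : IsUnit (7 : MvPolynomial (Fin 3) k) := by
    simpa using BP237Charts.isUnit_natCast_of_ne p k 7 (by norm_num) hp7
  have hd0 : pderiv 0 f = 3 * X 0 ^ 2 := by rw [hf, pderiv_zero_f]
  have hd1 : pderiv 1 f = 7 * X 1 ^ 6 := by rw [hf, pderiv_one_f]
  have hd2 : pderiv 2 f = 2 * X 2 := by rw [hf, pderiv_two_f]
  by_cases hm0 : pderiv 0 f ∈ Q.comap (Ideal.Quotient.mk (Ideal.span {f})); swap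
  · exact ClauseOfPderivNotMem.stub_clauseOfPderivNotMem p k 3 f Q 0 hm0 d hd s hs
  by_cases hm1 : pderiv 1 f ∈ Q.comap (Ideal.Quotient.mk (Ideal.span {f})); swap
  · exact ClauseOfPderivNotMem.stub_clauseOfPderivNotMem p k 3 f Q 1 hm1 d hd s hs
  by_cases hm2 : pderiv 2 f ∈ Q.comap (Ideal.Quotient.mk (Ideal.span {f})); swap
  · exact ClauseOfPderivNotMem.stub_clauseOfPderivNotMem p k 3 f Q 2 hm2 d hd s hs
  exfalso
  have hX0 : (X 0 : MvPolynomial (Fin 3) k) ∈ Q.comap (Ideal.Quotient.mk (Ideal.span {f})) := by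
    rw [hd0] at hm0
    exact hP₀.mem_of_pow_mem 2 ((Ideal.unit_mul_mem_iff_mem _ hu3).mp hm0)
  have hX1 : (X 1 : MvPolynomial (Fin 3) k) ∈ Q.comap (Ideal.Quotient.mk (Ideal.span {f})) := by
    rw [hd1] at hm1
    exact hP₀.mem_of_pow_mem 6 ((Ideal.unit_mul_mem_iff_mem _ hu7).mp hm1)
  have hX2 : (X 2 : MvPolynomial (Fin 3) k) ∈ Q.comap (Ideal.Quotient.mk (Ideal.span {f})) := by
    rw [hd2] at hm2
    exact (Ideal.unit_mul_mem_iff_mem _ hu2).mp hm2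
  obtain ⟨j, hj⟩ := hj
  apply hj
  fin_cases j
  · exact Ideal.mem_comap.mp hX0
  · exact Ideal.mem_comap.mp hX1
  · exact Ideal.mem_comap.mp hX2

/-! ## The target -/

/-- **ONE WEIGHTED BLOW-UP F-INJECTIVIZES THE BP(2,3,7) POINT** (plan-1's typed target `bp237WeightedFiModel`,
CRUX-PLAN §6): for every prime `p ∉ {2,3,7}` and field `k` of characteristic `p`, the surface
`Spec k[X₀,X₁,X₂]/(X₂² + X₀³ + X₁⁷)` has a proper birational model — the weighted blow-up of the origin with
weights `(14,6,21)`, realised as the blow-up of `I₈₄` — all of whose stalks are domains in which every system of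
parameters is weakly regular and generates a Frobenius closed ideal. Assembly: the weighted cone engine
`WeightedConeFiModel.stub_weightedConeFiModel` (#23) at `n = 3`, `N = 84`, `D = 42`, `c = (6,14,4)`, with
saturation `bp237VeroneseSplitting`, charts `bp237ChartX/Y/Z`, primality `prime_bp237` and the off-origin clause
`bp237OffOrigin`. [folklore] -/
theorem bp237WeightedFiModel : ∀ (p : ℕ) [Fact p.Prime] (k : Type) [Field k] [CharP k p], p ≠ 2 → p ≠ 3 → p ≠ 7 →
    ∀ (f : MvPolynomial (Fin 3) k), f = MvPolynomial.X 2 ^ 2 + MvPolynomial.X 0 ^ 3 + MvPolynomial.X 1 ^ 7 →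
    ∃ (X' : Scheme.{0}) (π : X' ⟶ Spec (.of (MvPolynomial (Fin 3) k ⧸ Ideal.span {f}))), IsProper π ∧
      Literature.AlgebraicGeometry.Resolution.IsBirational π ∧ ∀ y : X', IsDomain (X'.presheaf.stalk y) ∧
      ∀ d : ℕ, ringKrullDim (X'.presheaf.stalk y) = d → ∀ s : Fin d → X'.presheaf.stalk y,
        (Ideal.span (Set.range s)).radical.IsMaximal →
          RingTheory.Sequence.IsWeaklyRegular (X'.presheaf.stalk y) (List.ofFn s) ∧
          ∀ z : X'.presheaf.stalk y, (∃ e : ℕ, z ^ p ^ e ∈ Ideal.span ((fun w : X'.presheaf.stalk y => w ^ p ^ e) ''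
            (Ideal.span (Set.range s) : Set (X'.presheaf.stalk y)))) → z ∈ Ideal.span (Set.range s) := by
  intro p _ k _ _ hp2 hp3 hp7 f hf
  obtain ⟨hprime, hndvd⟩ := prime_bp237 k f hf
  have hfprime : (Ideal.span {f}).IsPrime := (Ideal.span_singleton_prime hprime.ne_zero).mpr hprime
  have hXne : ∀ v : Fin 3, Ideal.Quotient.mk (Ideal.span {f}) (MvPolynomial.X v) ≠ 0 := fun v h =>
    hndvd v (Ideal.mem_span_singleton.mp (Ideal.Quotient.eq_zero_iff_mem.mp h))
  -- the three cover charts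
  obtain ⟨cX⟩ : Nonempty _ := ⟨BP237Charts.bp237ChartX p k hp2 hp3 hp7 f _ hf rfl⟩
  obtain ⟨cY⟩ : Nonempty _ := ⟨BP237Charts.bp237ChartY p k hp2 hp3 hp7 f _ hf rfl⟩
  obtain ⟨cZ⟩ : Nonempty _ := ⟨BP237Charts.bp237ChartZ p k hp2 hp3 hp7 f _ hf rfl⟩
  refine WeightedConeFiModel.stub_weightedConeFiModel p k 3 ![14, 6, 21] 84 42 ![6, 14, 4] (by norm_num)
    (by decide) (BP237VeroneseSplitting.bp237VeroneseSplitting k) f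
    ![MvPolynomial.X 2 ^ 2 + 1 + MvPolynomial.X 1 ^ 7,
      MvPolynomial.X 2 ^ 2 + MvPolynomial.X 0 ^ 3 + 1,
      1 + MvPolynomial.X 0 ^ 3 + MvPolynomial.X 1 ^ 7]
    hfprime hXne ?_ ?_ ?_ (bp237OffOrigin p k hp2 hp3 hp7 f hf) ?_
  · -- the chart identities
    intro v
    fin_cases v
    · exact cX.1
    · exact cY.1
    · exact cZ.1
  · -- weighted homogeneity of the chart polynomials (`-42 = 0` in `ZMod w_v`)
    intro v
    fin_cases v
    · have e1 : (fun j : Fin 3 => if j = (0 : Fin 3) then (1 : ZMod ((![14, 6, 21] : Fin 3 → ℕ) 0))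
          else -(((![14, 6, 21] : Fin 3 → ℕ) j : ℕ) : ZMod ((![14, 6, 21] : Fin 3 → ℕ) 0))) =
          (![1, -6, -21] : Fin 3 → ZMod 14) := by
        funext j; fin_cases j <;> decide
      have e2 : (-((42 : ℕ) : ZMod ((![14, 6, 21] : Fin 3 → ℕ) 0))) = (0 : ZMod 14) := by decide
      have h := cX.2.1
      rw [← e1, ← e2] at h
      exact h
    · have e1 : (fun j : Fin 3 => if j = (1 : Fin 3) then (1 : ZMod ((![14, 6, 21] : Fin 3 → ℕ) 1))
          else -(((![14, 6, 21] : Fin 3 → ℕ) j : ℕ) : ZMod ((![14, 6, 21] : Fin 3 → ℕ) 1))) =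
          (![-14, 1, -21] : Fin 3 → ZMod 6) := by
        funext j; fin_cases j <;> decide
      have e2 : (-((42 : ℕ) : ZMod ((![14, 6, 21] : Fin 3 → ℕ) 1))) = (0 : ZMod 6) := by decide
      have h := cY.2.1
      rw [← e1, ← e2] at h
      exact h
    · have e1 : (fun j : Fin 3 => if j = (2 : Fin 3) then (1 : ZMod ((![14, 6, 21] : Fin 3 → ℕ) 2))
          else -(((![14, 6, 21] : Fin 3 → ℕ) j : ℕ) : ZMod ((![14, 6, 21] : Fin 3 → ℕ) 2))) =
          (![-14, -6, 1] : Fin 3 → ZMod 21) := by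
        funext j; fin_cases j <;> decide
      have e2 : (-((42 : ℕ) : ZMod ((![14, 6, 21] : Fin 3 → ℕ) 2))) = (0 : ZMod 21) := by decide
      have h := cZ.2.1
      rw [← e1, ← e2] at h
      exact h
  · -- no chart variable divides its chart polynomial
    intro v
    fin_cases v
    · exact cX.2.2.1
    · exact cY.2.2.1
    · exact cZ.2.2.1
  · -- the chart clauses (at every maximal ideal of `k[X]/(g_v)`)
    intro v
    fin_cases v
    · intro Q hQ _
      have hc' := cX.2.2.2
      exact @hc' Q hQ
    · intro Q hQ _
      have hc' := cY.2.2.2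
      exact @hc' Q hQ
    · intro Q hQ _
      have hc' := cZ.2.2.2
      exact @hc' Q hQ

end Summit.ResolutionOfSingularities.ResolutionOfSingularities.Theorems.FInjectiveMacaulayfication.BP237WeightedFiModel

end
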